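import Summits.QuantumFields.YangMills.Theorems.ColdStartUniversalityLatticeLangevinMartingaleCLT
import Summits.QuantumFields.YangMills.Theorems.ColdStartUniversalityLatticeLangevinBlockIncrements
import Summits.QuantumFields.YangMills.Theorems.ColdStartUniversalityLatticeLangevinPoissonEquation
import Summits.QuantumFields.YangMills.Theorems.ColdStartUniversalityLatticeLangevinAsymptoticVarianceNonneg
import HarnessLib

/-!
# Route `ColdStartUniversality` (fixed-cut-off SZZ dynamics, sampler package): THE TIME-AVERAGE CLT ESTIMATE AT FINITE TIME —
# `‖E exp(iθ T^(−1/2)∫₀ᵀ Ĝ(U_r)dr) − e^(−θ²σ²/2)‖ ≤ Φ_θ(η_b/b, (2β_u+2b)/√T, 1/J) + 2|θ|β_u/√T` for every tiling `T = J·b`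

Helper file (seat `ym-line-csu-p1`, g35; `--supports stmt-QuantumFields-24809`).  The quantitative heart of the central limit theorem for TIME
AVERAGES of the cold-start SZZ sampler (next file).  For every coupling there are `β_u, K ≥ 0` (`L, β'` only: the sup of the Poisson corrector
and the conditional Green–Kubo constant) such that for every realising kernel family, every progressively measurable strong solution from a
deterministic start on ANY space, every continuous `|G| ≤ 1` (`Ĝ = G − μ_(β')G`, `σ² = 2∫₀^∞⟨Ĝ,κ_tĜ⟩_μ dt ≥ 0`), every block length `b > 0`,
block number `J ≥ 1`, `T = J·b`, and real `θ` (★★ `norm_charFun_timeIntegral_sub_gaussian_le_of_prog`):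

  `‖E e^(iθ T^(−1/2) ∫_(0,T] Ĝ(U_r)dr) − e^(−θ²σ²/2)‖ ≤ e^(θ²σ²/2)·(θ²E + |θ|³e^(|θ|B) B (σ² + E) + θ⁴σ⁴/(4J) + (|θ|B + θ²B²/2) θ²σ²/2) + 2|θ|β_u/√T`,
  `E = η_b/b`, `η_b = K + 2β_u((bσ² + K)/√(1+b) + √(1+b)) + 4β_u²`, `B = (2β_u + 2b)/√T`.

Proof: Bernstein blocks — the block increments of the Poisson martingale (file 94a: orthogonal to the past, predictable variance `bσ²` up to
`η_b`) fed, after scaling by `T^(−1/2)`, to the martingale-CLT engine (files 92a–c) with the DETERMINISTIC proxy `v_k = bσ²/T` (so `V_J = σ²`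
exactly), plus the boundary term `(u(x) − u(U_T))/√T`.  Since `η_b/b = O(b^(−1/2))`, the right-hand side is `o(1)` when `b → ∞`, `b = o(√T)`.
THEOREMS ONLY, no definition, no sorry; [folklore] (Bhattacharya 1982 / Kipnis–Varadhan 1986 functional CLT for ergodic Markov processes, here
with explicit finite-time error).  HONEST FRAMING: fixed cut-off; `β_u, K` depend on `L, β'`; `UniformColdStartMixing` (24809) is NOT restated; no
crux, rung or summit statement is proved; the Yang–Mills mass gap is NOT proved.
-/

set_option autoImplicit false

noncomputable section

namespace Summit.QuantumFields.YangMills.Theorems.ColdStartUniversality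

open MeasureTheory ProbabilityTheory Filter Topology Set
open scoped NNReal ENNReal BigOperators
open Literature Literature.Probability.Process Literature.MathematicalPhysics.QuantumFieldTheory
open Literature.MathematicalPhysics.QuantumLattice (fundamentalRep fundamentalLatticeRep continuous_fundamentalRep)

variable {L : ℕ} [NeZero L]

/-- ★★ **Finite-time CLT estimate for time averages (Bernstein blocks).**  See the module docstring. [folklore] -/
theorem norm_charFun_timeIntegral_sub_gaussian_le_of_prog (L : ℕ) [NeZero L] (β' : ℝ) :
    ∃ βu K : ℝ, 0 ≤ βu ∧ 0 ≤ K ∧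
      ∀ (κ : ℝ≥0 → Kernel (GaugeConfig 3 L (Matrix.specialUnitaryGroup (Fin 2) ℂ))
          (GaugeConfig 3 L (Matrix.specialUnitaryGroup (Fin 2) ℂ))) [∀ t, IsMarkovKernel (κ t)],
        (∀ (t : ℝ≥0) (x : GaugeConfig 3 L (Matrix.specialUnitaryGroup (Fin 2) ℂ))
          (Ω : Type) [MeasurableSpace Ω] (P : Measure Ω) [IsProbabilityMeasure P]
          (W : ℝ≥0 → Ω → (Edge 3 L × NoiseIdx 2 → ℝ)) (hW : IsFlatBrownian W P)
          (U : ℝ≥0 → Ω → GaugeConfig 3 L (Matrix.specialUnitaryGroup (Fin 2) ℂ)),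
          (∀ ω, U 0 ω = x) →
          (latticeLangevinDynamics (fundamentalLatticeRep 2) β').IsSolution (fundamentalRep (Fin 2))
            hW.natFiltration P W U →
          κ t x = P.map (U t)) →
        ∀ (x : GaugeConfig 3 L (Matrix.specialUnitaryGroup (Fin 2) ℂ))
          (Ω : Type) [MeasurableSpace Ω] (P : Measure Ω) [IsProbabilityMeasure P]
          (W : ℝ≥0 → Ω → (Edge 3 L × NoiseIdx 2 → ℝ)) (hW : IsFlatBrownian W P)
          (U : ℝ≥0 → Ω → GaugeConfig 3 L (Matrix.specialUnitaryGroup (Fin 2) ℂ)),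
          (∀ ω, U 0 ω = x) →
          (latticeLangevinDynamics (fundamentalLatticeRep 2) β').IsSolution (fundamentalRep (Fin 2)) hW.natFiltration P W U →
          (∀ i : ℝ≥0, Measurable[@Prod.instMeasurableSpace (Set.Iic i) Ω inferInstance (hW.natFiltration i)]
            (fun q : Set.Iic i × Ω => U q.1 q.2)) →
        ∀ (G : GaugeConfig 3 L (Matrix.specialUnitaryGroup (Fin 2) ℂ) → ℝ), Continuous G → (∀ z, |G z| ≤ 1) →
        ∀ (σ2 : ℝ), σ2 = 2 * ∫ t in Ioi (0 : ℝ),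
            (∫ y, (G y - ∫ z, G z ∂(wilsonMeasure (d := 3) (L := L) (fundamentalRep (Fin 2)) β')) *
              (∫ z, (G z - ∫ z', G z' ∂(wilsonMeasure (d := 3) (L := L) (fundamentalRep (Fin 2)) β')) ∂(κ t.toNNReal y))
              ∂(wilsonMeasure (d := 3) (L := L) (fundamentalRep (Fin 2)) β')) →
        ∀ (b : ℝ), 0 < b → ∀ (J : ℕ), 1 ≤ J → ∀ (θ : ℝ),
          0 ≤ σ2 ∧
          ‖(∫ ω, Complex.exp (((θ * ((Real.sqrt (J * b))⁻¹ * ∫ r in Ioc (0 : ℝ) (J * b),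
              (G (U r.toNNReal ω) - ∫ z, G z ∂(wilsonMeasure (d := 3) (L := L) (fundamentalRep (Fin 2)) β'))) : ℝ) : ℂ) * Complex.I) ∂P) -
              Complex.exp (-((θ ^ 2 * σ2 / 2 : ℝ) : ℂ))‖ ≤
            Real.exp (θ ^ 2 * σ2 / 2) *
              (θ ^ 2 * ((K + 2 * βu * ((b * σ2 + K) / Real.sqrt (1 + b) + Real.sqrt (1 + b)) + 4 * βu ^ 2) / b) +
                |θ| ^ 3 * Real.exp (|θ| * ((2 * βu + 2 * b) / Real.sqrt (J * b))) * ((2 * βu + 2 * b) / Real.sqrt (J * b)) *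
                  (σ2 + (K + 2 * βu * ((b * σ2 + K) / Real.sqrt (1 + b) + Real.sqrt (1 + b)) + 4 * βu ^ 2) / b) +
                θ ^ 4 * σ2 ^ 2 / 4 * (J : ℝ)⁻¹ +
                (|θ| * ((2 * βu + 2 * b) / Real.sqrt (J * b)) + θ ^ 2 * ((2 * βu + 2 * b) / Real.sqrt (J * b)) ^ 2 / 2) * (θ ^ 2 * σ2 / 2)) +
            |θ| * (2 * βu) * (Real.sqrt (J * b))⁻¹ := by
  classical
  haveI := secondCountableTopology_su2
  haveI := borelSpace_config L
  obtain ⟨Cu, cu, hCu, hcu, hPoisAll⟩ := exists_poisson_solution L β'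
  obtain ⟨K, hK, hblocks⟩ := exists_blockIncrements L β'
  refine ⟨2 * Cu / cu, K, by positivity, hK, fun κ _ hreal x Ω _ P _ W hW U hU0 hU hprog G hGc hG1 σ2 hσ2 b hb J hJ θ => ?_⟩
  set μ : Measure (GaugeConfig 3 L (Matrix.specialUnitaryGroup (Fin 2) ℂ)) :=
    wilsonMeasure (d := 3) (L := L) (fundamentalRep (Fin 2)) β' with hμ
  haveI : IsProbabilityMeasure μ :=
    isProbabilityMeasure_wilsonMeasure (d := 3) (L := L) (fundamentalRep (Fin 2)) (continuous_fundamentalRep (Fin 2)) β'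
  set m : ℝ := ∫ z, G z ∂μ with hm
  have hG : Measurable G := hGc.measurable
  have hm1 : |m| ≤ 1 := by
    have hh := norm_integral_le_of_norm_le_const (μ := μ) (f := G) (C := 1)
      (Eventually.of_forall fun z => by simpa [Real.norm_eq_abs] using hG1 z)
    simpa [Real.norm_eq_abs] using hh
  set Gh : GaugeConfig 3 L (Matrix.specialUnitaryGroup (Fin 2) ℂ) → ℝ := fun z => G z - m with hGh
  have hGhc : Continuous Gh := hGc.sub continuous_const
  have hGhm : Measurable Gh := hG.sub measurable_const
  have hGhb : ∀ z, |Gh z| ≤ 2 := fun z => by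
    show |G z - m| ≤ 2
    have := abs_sub (G z) m
    linarith [hG1 z]
  have hGh0 : ∫ z, Gh z ∂μ = 0 := by
    simp only [hGh]
    rw [integral_sub ((integrable_const (1 : ℝ)).mono' hG.aestronglyMeasurable (Eventually.of_forall fun z => by
      simpa [Real.norm_eq_abs] using hG1 z)) (integrable_const m), integral_const, smul_eq_mul, probReal_univ, one_mul, hm]
    exact sub_self _
  have hσ0 : 0 ≤ σ2 := by rw [hσ2]; exact mul_nonneg (by norm_num) (greenKubo_nonneg L β' κ hreal hGc hG1)
  set βu : ℝ := 2 * Cu / cu with hβu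
  have hβ0 : 0 ≤ βu := by positivity
  have hmU : ∀ s : ℝ≥0, Measurable (U s) := fun s => (hU.adapted s).mono (hW.natFiltration.le s) le_rfl
  /- ### 1. The Poisson corrector and the block increments -/
  obtain ⟨u, huc, -, hub', -, hPois⟩ := hPoisAll κ hreal Gh hGhc hGh0 2 hGhb
  have hum : Measurable u := huc.measurable
  have hub : ∀ y, |u y| ≤ βu := fun y => (hub' y).trans (le_of_eq hβu.symm)
  obtain ⟨D, hDF, hDb, horth, hvar, htel⟩ := hblocks κ hreal x Ω P W hW U hU0 hU hprog G hGc hG1 u hum βu hub hPois b hb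
  set T : ℝ := J * b with hT
  have hJr : (1 : ℝ) ≤ J := by exact_mod_cast hJ
  have hT0 : 0 < T := by positivity
  have hsT : 0 < Real.sqrt T := Real.sqrt_pos.2 hT0
  set t : ℝ := (Real.sqrt T)⁻¹ with ht
  have ht0 : 0 < t := inv_pos.2 hsT
  have ht2 : t ^ 2 = T⁻¹ := by rw [ht, inv_pow, Real.sq_sqrt hT0.le]
  set ηb : ℝ := K + 2 * βu * ((b * σ2 + K) / Real.sqrt (1 + b) + Real.sqrt (1 + b)) + 4 * βu ^ 2 with hηb
  have hηb0 : 0 ≤ ηb := by positivity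
  -- `|σ²| = σ²` in file 94a's bound
  have hvar' : ∀ (k : ℕ) (Z : Ω → ℝ), Measurable[hW.natFiltration (((k : ℝ) * b).toNNReal)] Z → (∀ ω, 0 ≤ Z ω) →
      (∃ CZ : ℝ, ∀ ω, Z ω ≤ CZ) → |∫ ω, Z ω * (D k ω ^ 2 - b * σ2) ∂P| ≤ ηb * ∫ ω, Z ω ∂P := by
    intro k Z hZ hZ0 hZb
    have h := hvar k Z hZ hZ0 hZb
    rw [← hσ2, abs_of_nonneg hσ0] at h
    exact h
  /- ### 2. The engine with `D'_k = D_k/√T`, `v'_k = bσ²/T`, `n = J` -/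
  set D' : ℕ → Ω → ℝ := fun k ω => t * D k ω with hD'
  set v' : ℕ → Ω → ℝ := fun _ _ => t ^ 2 * (b * σ2) with hv'
  have hDm : ∀ k, Measurable (D k) := fun k => (hDF k).mono (hW.natFiltration.le _) le_rfl
  have hD'm : ∀ k, Measurable (D' k) := fun k => (hDm k).const_mul t
  have hv'm : ∀ k, Measurable (v' k) := fun _ => measurable_const
  have hD'b : ∀ k ω, |D' k ω| ≤ t * (2 * βu + 2 * b) := fun k ω => by
    simp only [hD']; rw [abs_mul, abs_of_pos ht0]; exact mul_le_mul_of_nonneg_left (hDb k ω) ht0.le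
  have hv'0 : ∀ (k : ℕ) (ω : Ω), 0 ≤ v' k ω := fun _ _ => by positivity
  have hv'b : ∀ (k : ℕ) (ω : Ω), v' k ω ≤ t ^ 2 * (b * σ2) := fun _ _ => le_rfl
  have hmono : ∀ j k : ℕ, j ≤ k → (((j : ℝ) * b).toNNReal) ≤ (((k : ℝ) * b).toNNReal) := fun j k hjk =>
    Real.toNNReal_le_toNNReal (mul_le_mul_of_nonneg_right (by exact_mod_cast hjk) hb.le)
  have hSF : ∀ k : ℕ, Measurable[hW.natFiltration (((k : ℝ) * b).toNNReal)] fun ω => ∑ j ∈ Finset.range k, D' j ω := fun k =>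
    Finset.measurable_sum _ fun j hj => by
      have hle : ((((j + 1 : ℕ) : ℝ) * b).toNNReal) ≤ (((k : ℝ) * b).toNNReal) := hmono (j + 1) k (Nat.succ_le_of_lt (Finset.mem_range.1 hj))
      exact ((hDF j).mono (hW.natFiltration.mono hle) le_rfl).const_mul t
  have hVF : ∀ k : ℕ, Measurable[hW.natFiltration (((k : ℝ) * b).toNNReal)] fun ω => ∑ j ∈ Finset.range k, v' j ω := fun k =>
    Finset.measurable_sum _ fun j _ => measurable_const
  have horth' : ∀ k < J, ∀ Z : Ω → ℝ, Measurable[hW.natFiltration (((k : ℝ) * b).toNNReal)] Z → (∀ ω, 0 ≤ Z ω) →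
      (∃ CZ : ℝ, ∀ ω, Z ω ≤ CZ) → ∫ ω, Z ω * D' k ω ∂P = 0 := fun k _ Z hZ hZ0 hZb => by
    have h1 := horth k Z hZ hZ0 hZb
    simp only [hD']
    rw [integral_congr_ae (ae_of_all _ fun ω => show Z ω * (t * D k ω) = t * (Z ω * D k ω) by ring), integral_const_mul, h1, mul_zero]
  have hvar'' : ∀ k < J, ∀ Z : Ω → ℝ, Measurable[hW.natFiltration (((k : ℝ) * b).toNNReal)] Z → (∀ ω, 0 ≤ Z ω) →
      (∃ CZ : ℝ, ∀ ω, Z ω ≤ CZ) → |∫ ω, Z ω * (D' k ω ^ 2 - v' k ω) ∂P| ≤ (t ^ 2 * ηb) * ∫ ω, Z ω ∂P := fun k _ Z hZ hZ0 hZb => by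
    have h1 := hvar' k Z hZ hZ0 hZb
    simp only [hD', hv']
    rw [integral_congr_ae (ae_of_all _ fun ω => show Z ω * ((t * D k ω) ^ 2 - t ^ 2 * (b * σ2)) = t ^ 2 * (Z ω * (D k ω ^ 2 - b * σ2)) by
      ring), integral_const_mul, abs_mul, abs_of_nonneg (sq_nonneg t), mul_assoc]
    exact mul_le_mul_of_nonneg_left h1 (sq_nonneg t)
  have hE := norm_integral_cexp_sum_sub_gaussian_le (fun k : ℕ => hW.natFiltration (((k : ℝ) * b).toNNReal))
    (fun k => hW.natFiltration.le _) D' v' hD'm hv'm (by positivity : (0 : ℝ) ≤ t * (2 * βu + 2 * b))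
    (by positivity : (0 : ℝ) ≤ t ^ 2 * (b * σ2)) (by positivity : (0 : ℝ) ≤ t ^ 2 * ηb) hD'b hv'0 hv'b hSF hVF J horth' hvar'' hσ0 θ
  -- `J t² b = 1`
  have hJt : (J : ℝ) * (t ^ 2 * b) = 1 := by
    rw [ht2, hT]; field_simp
  have hV : ∫ ω, |(∑ j ∈ Finset.range J, v' j ω) - σ2| ∂P = 0 := by
    have h1 : ∀ ω, (∑ j ∈ Finset.range J, v' j ω) - σ2 = 0 := fun ω => by
      simp only [hv', Finset.sum_const, Finset.card_range, nsmul_eq_mul]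
      rw [show (J : ℝ) * (t ^ 2 * (b * σ2)) = (J * (t ^ 2 * b)) * σ2 by ring, hJt, one_mul, sub_self]
    simp_rw [h1, abs_zero, integral_zero]
  have hJA : (J : ℝ) * (θ ^ 2 * (t ^ 2 * (b * σ2)) / 2) = θ ^ 2 * σ2 / 2 := by
    rw [show (J : ℝ) * (θ ^ 2 * (t ^ 2 * (b * σ2)) / 2) = (J * (t ^ 2 * b)) * (θ ^ 2 * σ2 / 2) by ring, hJt, one_mul]
  rw [hV, mul_zero, add_zero, hJA] at hE
  /- ### 3. Simplify `J · ρ'` -/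
  set B : ℝ := t * (2 * βu + 2 * b) with hB
  set E : ℝ := ηb / b with hEdef
  have hB_eq : (2 * βu + 2 * b) / Real.sqrt (J * b) = B := by rw [hB, ht, hT, div_eq_inv_mul]
  have hJρ : (J : ℝ) * Real.exp (θ ^ 2 * σ2 / 2) *
      (θ ^ 2 * (t ^ 2 * ηb) + |θ| ^ 3 * Real.exp (|θ| * (t * (2 * βu + 2 * b))) * (t * (2 * βu + 2 * b)) *
        (t ^ 2 * (b * σ2) + t ^ 2 * ηb) + (θ ^ 2 * (t ^ 2 * (b * σ2)) / 2) ^ 2 +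
        (|θ| * (t * (2 * βu + 2 * b)) + θ ^ 2 * (t * (2 * βu + 2 * b)) ^ 2 / 2) * (θ ^ 2 * (t ^ 2 * (b * σ2)) / 2)) =
      Real.exp (θ ^ 2 * σ2 / 2) * (θ ^ 2 * E + |θ| ^ 3 * Real.exp (|θ| * B) * B * (σ2 + E) + θ ^ 4 * σ2 ^ 2 / 4 * (J : ℝ)⁻¹ +
        (|θ| * B + θ ^ 2 * B ^ 2 / 2) * (θ ^ 2 * σ2 / 2)) := by
    have hJ0 : (J : ℝ) ≠ 0 := by positivity
    have hb0 : b ≠ 0 := hb.ne'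
    -- `J t² = 1/b`
    have hJt' : (J : ℝ) * t ^ 2 = b⁻¹ := by
      have := hJt; field_simp; linarith [this]
    simp only [hB, hEdef]
    have e1 : (J : ℝ) * (θ ^ 2 * (t ^ 2 * ηb)) = θ ^ 2 * (ηb / b) := by
      rw [show (J : ℝ) * (θ ^ 2 * (t ^ 2 * ηb)) = θ ^ 2 * ((J * t ^ 2) * ηb) by ring, hJt', div_eq_inv_mul]
    have e2 : (J : ℝ) * (t ^ 2 * (b * σ2) + t ^ 2 * ηb) = σ2 + ηb / b := by
      rw [show (J : ℝ) * (t ^ 2 * (b * σ2) + t ^ 2 * ηb) = (J * (t ^ 2 * b)) * σ2 + (J * t ^ 2) * ηb by ring, hJt, hJt', one_mul,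
        div_eq_inv_mul]
    have e3 : (J : ℝ) * (θ ^ 2 * (t ^ 2 * (b * σ2)) / 2) ^ 2 = θ ^ 4 * σ2 ^ 2 / 4 * (J : ℝ)⁻¹ := by
      have : (J : ℝ) * (θ ^ 2 * (t ^ 2 * (b * σ2)) / 2) ^ 2 = (J * (t ^ 2 * b)) ^ 2 * (θ ^ 4 * σ2 ^ 2 / 4) * (J : ℝ)⁻¹ := by
        field_simp; ring
      rw [this, hJt, one_pow, one_mul]
    have e4 : (J : ℝ) * (θ ^ 2 * (t ^ 2 * (b * σ2)) / 2) = θ ^ 2 * σ2 / 2 := hJA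
    calc (J : ℝ) * Real.exp (θ ^ 2 * σ2 / 2) *
          (θ ^ 2 * (t ^ 2 * ηb) + |θ| ^ 3 * Real.exp (|θ| * (t * (2 * βu + 2 * b))) * (t * (2 * βu + 2 * b)) *
            (t ^ 2 * (b * σ2) + t ^ 2 * ηb) + (θ ^ 2 * (t ^ 2 * (b * σ2)) / 2) ^ 2 +
            (|θ| * (t * (2 * βu + 2 * b)) + θ ^ 2 * (t * (2 * βu + 2 * b)) ^ 2 / 2) * (θ ^ 2 * (t ^ 2 * (b * σ2)) / 2))
        = Real.exp (θ ^ 2 * σ2 / 2) *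
          ((J : ℝ) * (θ ^ 2 * (t ^ 2 * ηb)) + |θ| ^ 3 * Real.exp (|θ| * (t * (2 * βu + 2 * b))) * (t * (2 * βu + 2 * b)) *
            ((J : ℝ) * (t ^ 2 * (b * σ2) + t ^ 2 * ηb)) + (J : ℝ) * (θ ^ 2 * (t ^ 2 * (b * σ2)) / 2) ^ 2 +
            (|θ| * (t * (2 * βu + 2 * b)) + θ ^ 2 * (t * (2 * βu + 2 * b)) ^ 2 / 2) * ((J : ℝ) * (θ ^ 2 * (t ^ 2 * (b * σ2)) / 2))) := by
          ring
      _ = Real.exp (θ ^ 2 * σ2 / 2) * (θ ^ 2 * (ηb / b) + |θ| ^ 3 * Real.exp (|θ| * (t * (2 * βu + 2 * b))) * (t * (2 * βu + 2 * b)) *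
            (σ2 + ηb / b) + θ ^ 4 * σ2 ^ 2 / 4 * (J : ℝ)⁻¹ +
            (|θ| * (t * (2 * βu + 2 * b)) + θ ^ 2 * (t * (2 * βu + 2 * b)) ^ 2 / 2) * (θ ^ 2 * σ2 / 2)) := by
          rw [e1, e2, e3, e4]
  rw [hJρ] at hE
  /- ### 4. The statistic: telescoping and the boundary term -/
  have hpathm : Measurable fun q : Ω × ℝ => U q.2.toNNReal q.1 :=
    measurable_uncurry_of_prog (Z := U) (fun n : ℕ => hW.natFiltration n) (fun n => hW.natFiltration.le n) (fun n => hprog n)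
  have hIm : Measurable fun ω => ∫ r in Ioc (0 : ℝ) (J * b), Gh (U r.toNNReal ω) := by
    have h1 : Measurable (Function.uncurry fun (ω : Ω) (r : ℝ) => Gh (U r.toNNReal ω)) := hGhm.comp hpathm
    exact (h1.stronglyMeasurable.integral_prod_right' (ν := volume.restrict (Ioc (0 : ℝ) (J * b)))).measurable
  have hTm : Measurable fun ω => (Real.sqrt (J * b))⁻¹ * ∫ r in Ioc (0 : ℝ) (J * b), Gh (U r.toNNReal ω) := hIm.const_mul _
  have hSm : Measurable fun ω => ∑ j ∈ Finset.range J, D' j ω := Finset.measurable_sum _ fun j _ => hD'm j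
  have hdiff : ∀ ω, |(∑ j ∈ Finset.range J, D' j ω) - (Real.sqrt (J * b))⁻¹ * ∫ r in Ioc (0 : ℝ) (J * b), Gh (U r.toNNReal ω)| ≤ t * (2 * βu) := by
    intro ω
    have h1 := htel J ω
    have hsum : ∑ j ∈ Finset.range J, D' j ω = t * ∑ j ∈ Finset.range J, D j ω := by simp only [hD']; rw [Finset.mul_sum]
    rw [hsum, h1, show (Real.sqrt (J * b))⁻¹ = t by rw [ht, hT], ← mul_sub,
      show u (U (((J : ℝ) * b).toNNReal) ω) - u x + (∫ r in Ioc (0 : ℝ) (J * b), Gh (U r.toNNReal ω)) -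
        (∫ r in Ioc (0 : ℝ) (J * b), Gh (U r.toNNReal ω)) = u (U (((J : ℝ) * b).toNNReal) ω) - u x by ring,
      abs_mul, abs_of_pos ht0]
    refine mul_le_mul_of_nonneg_left ((abs_sub _ _).trans ?_) ht0.le
    linarith [hub (U (((J : ℝ) * b).toNNReal) ω), hub x]
  have hpert := norm_integral_cexp_sub_integral_cexp_le (P := P) hSm hTm hdiff θ
  refine ⟨hσ0, ?_⟩
  have hsplit := norm_sub_le_norm_sub_add_norm_sub
    (∫ ω, Complex.exp (((θ * ((Real.sqrt (J * b))⁻¹ * ∫ r in Ioc (0 : ℝ) (J * b), Gh (U r.toNNReal ω)) : ℝ) : ℂ) * Complex.I) ∂P)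
    (∫ ω, Complex.exp (((θ * ∑ j ∈ Finset.range J, D' j ω : ℝ) : ℂ) * Complex.I) ∂P)
    (Complex.exp (-((θ ^ 2 * σ2 / 2 : ℝ) : ℂ)))
  rw [norm_sub_rev] at hpert
  have htot := hsplit.trans (add_le_add hpert hE)
  rw [hB_eq]
  calc ‖(∫ ω, Complex.exp (((θ * ((Real.sqrt (J * b))⁻¹ * ∫ r in Ioc (0 : ℝ) (J * b), Gh (U r.toNNReal ω)) : ℝ) : ℂ) * Complex.I) ∂P) -
        Complex.exp (-((θ ^ 2 * σ2 / 2 : ℝ) : ℂ))‖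
      ≤ |θ| * (t * (2 * βu)) + (Real.exp (θ ^ 2 * σ2 / 2) * (θ ^ 2 * E + |θ| ^ 3 * Real.exp (|θ| * B) * B * (σ2 + E) +
          θ ^ 4 * σ2 ^ 2 / 4 * (J : ℝ)⁻¹ + (|θ| * B + θ ^ 2 * B ^ 2 / 2) * (θ ^ 2 * σ2 / 2))) := htot
    _ = Real.exp (θ ^ 2 * σ2 / 2) * (θ ^ 2 * (ηb / b) + |θ| ^ 3 * Real.exp (|θ| * B) * B * (σ2 + ηb / b) +
          θ ^ 4 * σ2 ^ 2 / 4 * (J : ℝ)⁻¹ + (|θ| * B + θ ^ 2 * B ^ 2 / 2) * (θ ^ 2 * σ2 / 2)) + |θ| * (2 * βu) * (Real.sqrt (J * b))⁻¹ := by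
        simp only [hEdef]; rw [ht, hT]; ring
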